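import Mathlib
import HarnessLib

/-!
# Route `SqueezeCycle`, support `MiddleEigenvalueSign` (item stmt-NavierStokesRegularity-11613) —
# `−4 det S` carries the sign of the middle strain eigenvalue

For a trace-free real `3 × 3` matrix `A` let `S = ½ (A + Aᵀ)` and let `μ₀ ≥ μ₁ ≥ μ₂` be the
eigenvalues of the symmetric matrix `A + Aᵀ = 2 S` (Mathlib's antitone enumeration
`Matrix.IsHermitian.eigenvalues₀`). Then `−4 det S = ½ μ₁ |μ₀| |μ₂|`: indeed
`det S = ⅛ det (A + Aᵀ) = ⅛ μ₀ μ₁ μ₂` (determinant = product of eigenvalues), and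
`μ₀ + μ₁ + μ₂ = tr (A + Aᵀ) = 2 tr A = 0` with the ordering forces `μ₀ ≥ 0 ≥ μ₂`, so
`μ₀ μ₁ μ₂ = −μ₁ |μ₀| |μ₂|`. Together with Betchov's sign law `ω·Sω = 4 det A − 4 det S`
(`signLaw_proof`) this says that the local (non-null-Lagrangian) part of the enstrophy production
is signed by the MIDDLE eigenvalue of the strain (Neustupa–Penel 2001; Miller 2019, §1).
The statement is the Prop of
`Summit.NavierStokesRegularity.NavierStokesRegularity.Theses.SqueezeCycle.MiddleEigenvalueSign`,
restated verbatim so that this module does not import the route file.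

References: J. Neustupa, P. Penel, in: *Mathematical Fluid Mechanics*, Birkhäuser 2001, 237–265;
E. Miller, *A regularity criterion for the Navier–Stokes equation involving only the middle
eigenvalue of the strain tensor*, Arch. Ration. Mech. Anal. 235 (2020), doi:10.1007/s00205-019-01419-z.
-/

namespace Summit.NavierStokesRegularity.NavierStokesRegularity.Theorems

open scoped Matrix

/-- Bookkeeping on `Fin n` with `n = 3`: an antitone `f : Fin n → ℝ` has
`∏ f = f 0 * f 1 * f 2`, `∑ f = f 0 + f 1 + f 2` and `f 0 ≥ f 1 ≥ f 2`. (Used with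
`n = Fintype.card (Fin 3)`, the index type of `Matrix.IsHermitian.eigenvalues₀`.) -/
theorem antitone_fin_card_three_bookkeeping {n : ℕ} (hn : n = 3) [NeZero n] (f : Fin n → ℝ)
    (hf : Antitone f) :
    ∏ j, f j = f 0 * f 1 * f 2 ∧ ∑ j, f j = f 0 + f 1 + f 2 ∧ f 1 ≤ f 0 ∧ f 2 ≤ f 1 := by
  subst hn
  refine ⟨Fin.prod_univ_three f, Fin.sum_univ_three f, hf ?_, hf ?_⟩
  · rw [Fin.le_iff_val_le_val]; simp
  · rw [Fin.le_iff_val_le_val]; simp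

/-- **The middle-eigenvalue sign of `−4 det S`** (route `SqueezeCycle`, item `MiddleEigenvalueSign`,
stmt-NavierStokesRegularity-11613): for a trace-free real `3 × 3` matrix `A`, with
`μ = (Matrix.isHermitian_add_transpose_self A).eigenvalues₀` the antitone eigenvalues of `A + Aᵀ`,
`-4 * det (½ (A + Aᵀ)) = ½ * μ 1 * |μ 0| * |μ 2|`. Proof: `det = ∏ μᵢ`, `0 = tr (A + Aᵀ) = ∑ μᵢ`,
and `μ₀ ≥ μ₁ ≥ μ₂` with zero sum gives `μ₀ ≥ 0 ≥ μ₂`. -/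
theorem middleEigenvalueSign_proof :
    ∀ A : Matrix (Fin 3) (Fin 3) ℝ, A.trace = 0 →
      -4 * (((1 / 2 : ℝ) • (A + Aᵀ))).det =
        (1 / 2) * (Matrix.isHermitian_add_transpose_self A).eigenvalues₀ 1 *
          |(Matrix.isHermitian_add_transpose_self A).eigenvalues₀ 0| *
            |(Matrix.isHermitian_add_transpose_self A).eigenvalues₀ 2| := by
  intro A hA
  set hM := Matrix.isHermitian_add_transpose_self A
  -- the equivalence between the two index types of the eigenvalue enumerations
  set e : Fin (Fintype.card (Fin 3)) ≃ Fin 3 := Fintype.equivOfCardEq (Fintype.card_fin _)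
  have key : ∀ j, hM.eigenvalues (e j) = hM.eigenvalues₀ j := fun j => by
    simp [Matrix.IsHermitian.eigenvalues, e]
  -- over `ℝ` the conjugate transpose is the transpose
  have hHT : A + Aᴴ = A + Aᵀ := by rw [Matrix.conjTranspose_eq_transpose_of_trivial]
  -- determinant and trace through the eigenvalues
  have hdet : (A + Aᵀ).det = ∏ j, hM.eigenvalues₀ j := by
    rw [← hHT, hM.det_eq_prod_eigenvalues, ← e.prod_comp]
    simp only [RCLike.ofReal_real_eq_id, id_eq, key]
  have htr : (A + Aᵀ).trace = ∑ j, hM.eigenvalues₀ j := by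
    rw [← hHT, hM.trace_eq_sum_eigenvalues, ← e.sum_comp]
    simp only [RCLike.ofReal_real_eq_id, id_eq, key]
  have htr0 : (A + Aᵀ).trace = 0 := by
    rw [Matrix.trace_add, Matrix.trace_transpose, hA, add_zero]
  obtain ⟨hp, hs, h10, h21⟩ :=
    antitone_fin_card_three_bookkeeping (Fintype.card_fin 3) hM.eigenvalues₀ hM.eigenvalues₀_antitone
  set μ := hM.eigenvalues₀
  have hsum : μ 0 + μ 1 + μ 2 = 0 := by rw [← hs, ← htr, htr0]
  have h0 : 0 ≤ μ 0 := by linarith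
  have h2 : μ 2 ≤ 0 := by linarith
  have hsm : ((1 / 2 : ℝ) • (A + Aᵀ)).det = (1 / 2) ^ 3 * (A + Aᵀ).det := by
    rw [Matrix.det_smul, Fintype.card_fin]
  rw [hsm, hdet, hp, abs_of_nonneg h0, abs_of_nonpos h2]
  ring

end Summit.NavierStokesRegularity.NavierStokesRegularity.Theorems
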